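import Literature.NumberTheory.EllipticCurves.SerreOpenImageNormalizerCaseProofs
import Literature.NumberTheory.EllipticCurves.SerreOpenImageDensityProofs
import Literature.NumberTheory.EllipticCurves.ModPIrreducibleCofinite
import Literature.NumberTheory.GaloisRepresentations.SerreInertiaImageGL2Fp
import Literature.NumberTheory.GaloisRepresentations.QuadraticUnramifiedOutsideFinite
import HarnessLib

/-!
# Serre's open image theorem over `ℚ` from the local structure of `E[ℓ]` at `ℓ` (§1.11) and the
# density `0` of the supersingular primes — the assembly of §4.2

Topic `NumberTheory/EllipticCurves`.  Theorems only (nothing is defined, no named fact).  This file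
assembles the proof of J.-P. Serre, *Propriétés galoisiennes des points d'ordre fini des courbes
elliptiques*, Invent. Math. 15 (1972), §4.2, Théorème 2 (the tree's named fact
`Literature.NumberTheory.EllipticCurves.serre_open_image`) for an elliptic curve `E/ℚ` in global
minimal form, **conditionally on two inputs kept as explicit hypotheses**:

1. `hF` — **the local input at `ℓ`** (Serre 1972, §1.11, Prop. 11 with its Corollaire, and
   Prop. 12 c); for `e = 1`, i.e. `ℓ` unramified in `K = ℚ`): for a prime `ℓ` of good reduction
   and a prime `𝔏` of `\bar ℤ` above `ℓ`, with `I = I_𝔏 ≤ Γ_ℚ` the inertia group, *either*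
   (ordinary reduction, Prop. 11: `0 → X_ℓ → E_ℓ → Ẽ_ℓ → 0`, `χ_Y = 1`, `χ_X = θ_{ℓ-1}` onto
   `𝔽_ℓˣ`) there is `v₀ ∈ E[ℓ] ∖ 0` with `τ x - x ∈ 𝔽_ℓ v₀` for all `τ ∈ I`, `x ∈ E[ℓ]`, and
   `τ v₀ = a v₀` for every `a ∈ 𝔽_ℓˣ` and some `τ ∈ I`; *or* (supersingular reduction,
   Prop. 12 c)) the image of `I` in `Aut(E[ℓ])` is cyclic of order `ℓ² - 1`.  This is the part of
   Serre's paper resting on the reduction theory of elliptic curves over local fields and their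
   formal groups, absent from the tree; it is *not* restated as a named fact here.
2. `hSS` — the good supersingular primes of `E` have natural density `0` (for `E` without complex
   multiplication this is the tree's named fact `WeierstrassCurve.serre_supersingular_density_zero`,
   Serre 1981 §8 / 1968 IV-13, used by Serre in §4.2 c) as "[26], cor. 1 au th. 6").

Everything else is proved in the tree: §2 (Prop. 14, 15, 17: `SerreCartan*`, `SerreProp14GL2Fp`,
`SerreOpenImageGroupLemmas`, `SerreInertiaImageGL2Fp`), §5.2 (iii)–(iv)
(`SerreOpenImageDeterminantProofs`),
§4.2 b) (`SerreOpenImageNormalizerCaseProofs`), the Borel case i) through the irreducibility of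
`E[ℓ]` for large `ℓ` (`ModPIrreducibleCofinite`, Serre MG IV-9 / Silverman IX.6.3, replacing
steps d)–e) of Serre's proof over `ℚ`), and §4.2 c): Lemme 2 at `v ∤ l`
(`inertia_le_comap_cartan`), the finiteness of the quadratic characters unramified outside the bad
primes (`QuadraticUnramifiedOutsideFinite`, replacing step a) over `ℚ`), Lemme 3
(`SerreOpenImageLemmeTroisProofs`) and the density contradiction (`SerreOpenImageDensityProofs`).

* `WeierstrassCurve.exists_quadraticSubgroup_of_not_hasSurjectiveModNGaloisRep` — §4.2 b)–c) for
  one prime `ℓ ≥ 7` of good reduction with `E[ℓ]` irreducible and `ρ̄_{E,ℓ}` not onto: the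
  subgroup `U_ℓ = Gal(ℚ̄/K'_ℓ)`, open of index `2`, unramified outside the bad primes (Lemme 2,
  including at `v ∣ l` via Prop. 14), with the divisibility `ℓ ∣ a_p` at the primes inert in `K'_ℓ`.
* `WeierstrassCurve.exists_forall_hasSurjectiveModNGaloisRep_of_inertia_shape` — **Théorème 2
  over `ℚ` for a globally minimal `E`, from `hF` and `hSS`**.
* `WeierstrassCurve.serre_open_image_minimal_of_inertia_shape` — the same for all globally
  minimal non-CM curves, from `hF` and the named fact `serre_supersingular_density_zero`.

## References

* [Serre1972] J.-P. Serre, Invent. Math. 15 (1972) 259–331: §1.11 (Prop. 11, Cor.; Prop. 12),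
  §2.2 Prop. 14, §2.4 Prop. 15, §2.7 Prop. 17, §4.2 (Théorème 2, a)–c), Lemmes 2–3), §5.2.
* [Serre1981] J.-P. Serre, Publ. Math. IHÉS 54 (1981), §8.
-/

noncomputable section

open scoped Classical NumberField
open IsDedekindDomain Field Matrix

namespace WeierstrassCurve

open Literature.NumberTheory.EllipticCurves Literature.NumberTheory.GaloisRepresentations
  Literature.NumberTheory.GaloisRepresentations.Serre1972 NumberField Rat.HeightOneSpectrum

variable (W : WeierstrassCurve ℚ) [W.IsElliptic] [W.IsGloballyMinimal]

/-- Every maximal ideal of `\bar ℤ` lies above a finite place of `ℚ`. [folklore] -/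
theorem _root_.Literature.NumberTheory.EllipticCurves.exists_mem_primesAbove_of_isMaximal
    (𝔓 : Ideal (absIntegers (𝓞 ℚ) ℚ)) [h𝔓 : 𝔓.IsMaximal] :
    ∃ v : HeightOneSpectrum (𝓞 ℚ), 𝔓 ∈ v.primesAbove := by
  haveI : (𝔓.under (𝓞 ℚ)).IsMaximal := Ideal.IsMaximal.under (𝓞 ℚ) 𝔓
  have hne : 𝔓.under (𝓞 ℚ) ≠ ⊥ :=
    Ring.ne_bot_of_isMaximal_of_not_isField inferInstance (RingOfIntegers.not_isField ℚ)
  exact ⟨⟨𝔓.under (𝓞 ℚ), inferInstance, hne⟩, h𝔓.isPrime, ⟨rfl⟩⟩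

/-- **Serre 1972, §4.2 b)–c) for one prime `ℓ`, over `ℚ`.**  Let `E = W/ℚ` be in global minimal
form, `s` a finite set of primes containing the primes of bad reduction, and `ℓ ≥ 7` a prime of
good reduction at which the local input `hF` (§1.11) holds, `E[ℓ]` is irreducible and `ρ̄_{E,ℓ}` is
not onto.  Then there is a subgroup `U ≤ Γ_ℚ` — `Gal(ℚ̄/K'_l)` for the quadratic field `K'_l` of
case ii) — which is open of index `2`, contains the inertia group of every maximal ideal of `\bar ℤ`
not meeting `s` (Lemme 2: at the good `p ≠ ℓ` because `E[ℓ]` is unramified there; at `p = ℓ` by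
Prop. 14, the image of inertia being a split half-Cartan or a non-split Cartan subgroup since
`ℓ ∤ #φ_l(G)` by Prop. 15), and such that `ℓ ∣ a_p` for every good `p ≠ ℓ` with an arithmetic
Frobenius outside `U` (Lemme 3). [cite: Serre1972, §4.2 b)–c), Lemme 2, Lemme 3] -/
theorem exists_quadraticSubgroup_of_not_hasSurjectiveModNGaloisRep (s : Finset ℕ)
    (hs : ∀ (p : ℕ) [Fact p.Prime], p ∉ s → W.HasGoodReductionAtPrime p)
    (ℓ : ℕ) [Fact ℓ.Prime] (hℓ7 : 7 ≤ ℓ)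
    (hF : ∀ v : HeightOneSpectrum (𝓞 ℚ), (primesEquiv v : ℕ) = ℓ → ∀ 𝔏 ∈ v.primesAbove,
      (letI : Module (ZMod ℓ) (geomTorsion W ℓ) := AddSubgroup.torsionBy.zmodModule
       ∃ v₀ : geomTorsion W ℓ, v₀ ≠ 0 ∧
         (∀ τ ∈ 𝔏.inertia (absoluteGaloisGroup ℚ), ∀ x : geomTorsion W ℓ,
            ∃ b : ZMod ℓ, τ • x - x = b • v₀) ∧
         (∀ a : (ZMod ℓ)ˣ, ∃ τ ∈ 𝔏.inertia (absoluteGaloisGroup ℚ),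
            τ • v₀ = (a : ZMod ℓ) • v₀)) ∨
      (IsCyclic ((𝔏.inertia (absoluteGaloisGroup ℚ)).map (galoisRepTorsion W ℓ)) ∧
        Nat.card ((𝔏.inertia (absoluteGaloisGroup ℚ)).map (galoisRepTorsion W ℓ)) = ℓ ^ 2 - 1))
    (hirr : W.HasIrreducibleModPGaloisRep ℓ) (hns : ¬ W.HasSurjectiveModNGaloisRep ℓ) :
    ∃ U : Subgroup (absoluteGaloisGroup ℚ), IsOpen (U : Set (absoluteGaloisGroup ℚ)) ∧
      U.index = 2 ∧
      (∀ (𝔓 : Ideal (absIntegers (𝓞 ℚ) ℚ)), 𝔓.IsMaximal →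
        (∀ q ∈ s, (q : absIntegers (𝓞 ℚ) ℚ) ∉ 𝔓) → 𝔓.inertia (absoluteGaloisGroup ℚ) ≤ U) ∧
      (∀ (p : ℕ) [Fact p.Prime], p ≠ ℓ → W.HasGoodReductionAtPrime p →
        ∀ v : HeightOneSpectrum (𝓞 ℚ), (primesEquiv v : ℕ) = p →
        ∀ 𝔓 ∈ v.primesAbove, ∀ σ : absoluteGaloisGroup ℚ, IsArithFrobAt (𝓞 ℚ) σ 𝔓 → σ ∉ U →
          (ℓ : ℤ) ∣ W.frobeniusTrace p) := by
  letI : Module (ZMod ℓ) (geomTorsion W ℓ) := AddSubgroup.torsionBy.zmodModule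
  have hℓp : ℓ.Prime := Fact.out
  have hℓ2 : ℓ ≠ 2 := by omega
  have hℓ3 : 3 ≤ ℓ := by omega
  have hℓ5 : ℓ ≠ 5 := by omega
  have hℓ5' : 5 ≤ ℓ := by omega
  -- the frame and the image `G`
  obtain ⟨e, Φ, he, htr, -, -, -⟩ := exists_frame_galoisRepTorsion_rat W ℓ
  set ρ := galoisRepTorsion W ℓ with hρ
  set G : Subgroup (GL (Fin 2) (ZMod ℓ)) := ρ.range.map Φ.toMonoidHom with hG
  have hGtop : G ≠ ⊤ := fun h ↦ hns ((map_range_galoisRepTorsion_eq_top_iff W ℓ Φ).mp h)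
  -- `ℓ ∤ #G` (Prop. 15: otherwise `G` is Borel or all of `GL₂`)
  have hℓG : ¬ ℓ ∣ Nat.card G := by
    intro hdvd
    rcases eq_top_or_borel_of_dvd_card G hdvd (exists_mem_map_range_det_eq W ℓ Φ e he) with
      h | ⟨v, hv, hB⟩
    · exact hGtop h
    · exact not_le_eigenvectorStabilizer_of_hasIrreducibleModPGaloisRep W ℓ Φ e he hirr hv hB
  -- the image `H_𝔏 = Φ(ρ̄(I_𝔏))` of an inertia group above `ℓ`: its shape, and `H_𝔏 ≤ G`
  obtain ⟨vℓ, hvℓ⟩ : ∃ v : HeightOneSpectrum (𝓞 ℚ), (primesEquiv v : ℕ) = ℓ :=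
    ⟨primesEquiv.symm ⟨ℓ, hℓp⟩, by rw [Equiv.apply_symm_apply]⟩
  have hHle : ∀ 𝔏 : Ideal (absIntegers (𝓞 ℚ) ℚ),
      ((𝔏.inertia (absoluteGaloisGroup ℚ)).map ρ).map Φ.toMonoidHom ≤ G := fun 𝔏 ↦
    Subgroup.map_mono (fun x ⟨τ, _, hτ⟩ ↦ ⟨τ, hτ⟩)
  have hshape : ∀ 𝔏 ∈ vℓ.primesAbove,
      (∃ P : GL (Fin 2) (ZMod ℓ),
        ((𝔏.inertia (absoluteGaloisGroup ℚ)).map ρ).map Φ.toMonoidHom = halfSplitCartan P) ∨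
      ∃ k : Subalgebra (ZMod ℓ) (Matrix (Fin 2) (Fin 2) (ZMod ℓ)), IsField k ∧
        Module.finrank (ZMod ℓ) k = 2 ∧
        ((𝔏.inertia (absoluteGaloisGroup ℚ)).map ρ).map Φ.toMonoidHom = unitGroup k := by
    intro 𝔏 h𝔏
    have hℓH : ¬ ℓ ∣ Nat.card (((𝔏.inertia (absoluteGaloisGroup ℚ)).map ρ).map Φ.toMonoidHom) :=
      fun h ↦ hℓG (h.trans (Subgroup.card_dvd_of_le (hHle 𝔏)))
    rcases hF vℓ hvℓ 𝔏 h𝔏 with ⟨v₀, hv₀, hquot, hsurj⟩ | ⟨hcyc, hcard⟩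
    · left
      obtain ⟨P, -, hP⟩ := eq_halfSplitCartan_map_of_not_dvd_card e Φ he
        (I := (𝔏.inertia (absoluteGaloisGroup ℚ)).map ρ) hv₀
        (fun τ' ⟨τ, hτ, hτ'⟩ x ↦ by subst hτ'; exact hquot τ hτ x)
        (fun a ↦ by
          obtain ⟨τ, hτ, hτv⟩ := hsurj a
          exact ⟨ρ τ, ⟨τ, hτ, rfl⟩, hτv⟩) hℓH
      exact ⟨P, hP⟩
    · right
      exact exists_isField_eq_unitGroup_map_of_isCyclic Φ hcyc hcard
  -- the local input at some `𝔏 ∣ ℓ` feeds Prop. 17 (through `SerreOpenImageNormalizerCaseProofs`)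
  obtain ⟨𝔏₀, h𝔏₀⟩ := vℓ.primesAbove_nonempty
  have hloc : (∃ P : GL (Fin 2) (ZMod ℓ), halfSplitCartan P ≤ G) ∨
      ∃ k : Subalgebra (ZMod ℓ) (Matrix (Fin 2) (Fin 2) (ZMod ℓ)), IsField k ∧
        Module.finrank (ZMod ℓ) k = 2 ∧ unitGroup k ≤ G := by
    rcases hshape 𝔏₀ h𝔏₀ with ⟨P, hP⟩ | ⟨k, hk, h2, hkH⟩
    · exact Or.inl ⟨P, hP ▸ hHle 𝔏₀⟩
    · exact Or.inr ⟨k, hk, h2, hkH ▸ hHle 𝔏₀⟩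
  obtain ⟨C, hC, hGN, hGC⟩ :=
    exists_cartan_normalizer_of_not_hasSurjectiveModNGaloisRep W ℓ Φ e he hℓ2 hℓ5 hloc hirr hns
  have hCℓ : (∃ P : GL (Fin 2) (ZMod ℓ), C = splitCartan P) → ℓ ≠ 2 := fun _ ↦ hℓ2
  -- the subgroup `U = ρ̄⁻¹(Φ⁻¹(C))`
  refine ⟨(C.comap Φ.toMonoidHom).comap ρ, isOpen_comap_cartan W ℓ Φ,
    index_comap_cartan_eq_two W ℓ Φ hC hCℓ hGN hGC, ?_, ?_⟩
  · -- Lemme 2: unramified outside `s`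
    intro 𝔓 h𝔓max h𝔓s
    haveI := h𝔓max
    obtain ⟨v, h𝔓v⟩ := exists_mem_primesAbove_of_isMaximal 𝔓
    set p : ℕ := (primesEquiv v : ℕ) with hp
    haveI hpf : Fact p.Prime := ⟨(primesEquiv v).2⟩
    have hps : p ∉ s := fun hmem ↦ h𝔓s p hmem (Rat.natCast_natGenerator_mem_of_mem_primesAbove h𝔓v)
    have hgood : W.HasGoodReductionAtPrime p := hs p hps
    by_cases hpℓ : p = ℓ
    · -- at `ℓ`: the image of inertia is a half-split Cartan or a non-split Cartan inside `N(C)`,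
      -- hence inside `C` (Prop. 14)
      have h𝔓ℓ : 𝔓 ∈ vℓ.primesAbove := by
        have : v = vℓ := primesEquiv.injective (Subtype.ext (by rw [← hp, hpℓ, hvℓ]))
        rw [← this]; exact h𝔓v
      have hHN : ((𝔓.inertia (absoluteGaloisGroup ℚ)).map ρ).map Φ.toMonoidHom ≤
          Subgroup.normalizer (C : Set (GL (Fin 2) (ZMod ℓ))) := (hHle 𝔓).trans hGN
      have hHC : ((𝔓.inertia (absoluteGaloisGroup ℚ)).map ρ).map Φ.toMonoidHom ≤ C := by
        rcases hshape 𝔓 h𝔓ℓ with ⟨P, hP⟩ | ⟨k, hk, h2, hkH⟩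
        · rw [hP] at hHN ⊢
          exact prop14_halfSplitCartan hC hℓ5' hHN
        · rw [hkH] at hHN ⊢
          exact (prop14_unitGroup hC hℓ3 hk h2 hHN).le
      intro τ hτ
      rw [mem_comap_cartan_iff]
      exact hHC ⟨ρ τ, ⟨τ, hτ, rfl⟩, rfl⟩
    · exact inertia_le_comap_cartan W ℓ Φ hpℓ hgood rfl h𝔓v
  · -- Lemme 3
    intro p _ hpℓ hgood v hv 𝔓 h𝔓 σ hσ hσU
    exact natCast_dvd_frobeniusTrace_of_not_mem_comap_cartan W ℓ Φ htr hC hCℓ hGN hpℓ hgood hv h𝔓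
      hσ hσU

/-- **Serre 1972, §4.2, Théorème 2 over `ℚ`, from the local input of §1.11 and the density `0` of
the supersingular primes.**  Let `E = W/ℚ` be an elliptic curve in global minimal form whose good
supersingular primes have natural density `0`, and assume the local structure `hF` of `E[ℓ]` at
the inertia groups above every prime `ℓ` of good reduction (Serre 1972, §1.11, Prop. 11 with
Cor., Prop. 12 c)).  Then `ρ̄_{E,ℓ} : Γ_ℚ → Aut(E[ℓ])` is onto for every sufficiently large
prime `ℓ`.  Proof (§4.2): otherwise there are infinitely many exceptional `ℓ ≥ 7` of good
reduction with `E[ℓ]` irreducible (`finite_setOf_not_hasIrreducibleModPGaloisRep_rat`); each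
gives a quadratic `U_ℓ` unramified outside the bad primes
(`exists_quadraticSubgroup_of_not_hasSurjectiveModNGaloisRep`); these are finitely many
(`finite_setOf_index_eq_two_inertia_le`), so one `U` serves infinitely many `ℓ`, and then every
good prime with a Frobenius outside `U` has `a_p = 0` (Lemme 3), contradicting the density
hypothesis (`false_of_frobenius_not_mem_subset_density_zero`).
[cite: Serre1972, §4.2, Théorème 2] -/
theorem exists_forall_hasSurjectiveModNGaloisRep_of_inertia_shape
    (hSS : HasPrimeDensity W.goodSupersingularPrimes 0)
    (hF : ∀ (ℓ : ℕ) [Fact ℓ.Prime], W.HasGoodReductionAtPrime ℓ →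
      ∀ v : HeightOneSpectrum (𝓞 ℚ), (primesEquiv v : ℕ) = ℓ → ∀ 𝔏 ∈ v.primesAbove,
        (letI : Module (ZMod ℓ) (geomTorsion W ℓ) := AddSubgroup.torsionBy.zmodModule
         ∃ v₀ : geomTorsion W ℓ, v₀ ≠ 0 ∧
           (∀ τ ∈ 𝔏.inertia (absoluteGaloisGroup ℚ), ∀ x : geomTorsion W ℓ,
              ∃ b : ZMod ℓ, τ • x - x = b • v₀) ∧
           (∀ a : (ZMod ℓ)ˣ, ∃ τ ∈ 𝔏.inertia (absoluteGaloisGroup ℚ),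
              τ • v₀ = (a : ZMod ℓ) • v₀)) ∨
        (IsCyclic ((𝔏.inertia (absoluteGaloisGroup ℚ)).map (galoisRepTorsion W ℓ)) ∧
          Nat.card ((𝔏.inertia (absoluteGaloisGroup ℚ)).map (galoisRepTorsion W ℓ)) =
            ℓ ^ 2 - 1)) :
    ∃ p₀ : ℕ, ∀ p : ℕ, p.Prime → p₀ ≤ p → W.HasSurjectiveModNGaloisRep p := by
  by_contra hneg
  push Not at hneg
  -- the bad primes `s`, the exceptional set, and the infinite set `L` of exceptional `ℓ`
  have hbadfin := W.finite_setOf_prime_not_hasGoodReductionAtPrime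
  set s : Finset ℕ := hbadfin.toFinset with hsdef
  have hsprime : ∀ q ∈ s, q.Prime := by
    intro q hq
    obtain ⟨hq, -⟩ := hbadfin.mem_toFinset.mp hq
    exact hq.out
  have hs : ∀ (p : ℕ) [Fact p.Prime], p ∉ s → W.HasGoodReductionAtPrime p := by
    intro p hp hps
    by_contra h
    exact hps (hbadfin.mem_toFinset.mpr ⟨hp, h⟩)
  have hirrfin := finite_setOf_not_hasIrreducibleModPGaloisRep_rat W
  set L : Set ℕ := {ℓ | ℓ.Prime ∧ ¬ W.HasSurjectiveModNGaloisRep ℓ} \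
    ((Set.Iio 7 ∪ ↑s) ∪ {ℓ | ℓ.Prime ∧ ¬ W.HasIrreducibleModPGaloisRep ℓ}) with hLdef
  have hLinf : L.Infinite := by
    refine Set.Infinite.sdiff ?_ (((Set.finite_Iio 7).union s.finite_toSet).union hirrfin)
    refine Set.infinite_of_forall_exists_gt fun a ↦ ?_
    obtain ⟨p, hp, hap, hns⟩ := hneg (a + 1)
    exact ⟨p, ⟨hp, hns⟩, by omega⟩
  -- for `ℓ ∈ L`: the quadratic subgroup `U_ℓ`
  have hLprop : ∀ ℓ ∈ L, ℓ.Prime ∧ ¬ W.HasSurjectiveModNGaloisRep ℓ ∧ 7 ≤ ℓ ∧ ℓ ∉ s ∧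
      W.HasIrreducibleModPGaloisRep ℓ := by
    rintro ℓ ⟨⟨hℓ, hns⟩, hnot⟩
    simp only [Set.mem_union, Set.mem_Iio, Finset.mem_coe, Set.mem_setOf_eq, not_or, not_lt,
      not_and, not_not] at hnot
    exact ⟨hℓ, hns, hnot.1.1, hnot.1.2, hnot.2 hℓ⟩
  set 𝒰 : Set (Subgroup (absoluteGaloisGroup ℚ)) := {U | IsOpen (U : Set (absoluteGaloisGroup ℚ)) ∧
      U.index = 2 ∧ ∀ (𝔓 : Ideal (absIntegers (𝓞 ℚ) ℚ)), 𝔓.IsMaximal →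
        (∀ q ∈ s, (q : absIntegers (𝓞 ℚ) ℚ) ∉ 𝔓) → 𝔓.inertia (absoluteGaloisGroup ℚ) ≤ U}
    with h𝒰def
  have h𝒰fin : 𝒰.Finite := finite_setOf_index_eq_two_inertia_le s hsprime
  have key : ∀ ℓ ∈ L, ∃ U ∈ 𝒰, ∀ (p : ℕ) [Fact p.Prime], p ≠ ℓ → W.HasGoodReductionAtPrime p →
      ∀ v : HeightOneSpectrum (𝓞 ℚ), (primesEquiv v : ℕ) = p →
      ∀ 𝔓 ∈ v.primesAbove, ∀ σ : absoluteGaloisGroup ℚ, IsArithFrobAt (𝓞 ℚ) σ 𝔓 → σ ∉ U →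
        (ℓ : ℤ) ∣ W.frobeniusTrace p := by
    intro ℓ hℓL
    obtain ⟨hℓ, hns, hℓ7, hℓs, hirr⟩ := hLprop ℓ hℓL
    haveI := Fact.mk hℓ
    obtain ⟨U, hUo, hUi, hUI, hU3⟩ :=
      W.exists_quadraticSubgroup_of_not_hasSurjectiveModNGaloisRep s hs ℓ hℓ7
        (hF ℓ (hs ℓ hℓs)) hirr hns
    exact ⟨U, ⟨hUo, hUi, hUI⟩, hU3⟩
  choose! Uof hUof𝒰 hUof3 using key
  -- pigeonhole: one `U ∈ 𝒰` serves an infinite `L' ⊆ L`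
  obtain ⟨U₀, hU₀𝒰, hL'inf⟩ : ∃ U₀ ∈ 𝒰, {ℓ ∈ L | Uof ℓ = U₀}.Infinite := by
    haveI : Infinite L := hLinf.to_subtype
    haveI : Finite 𝒰 := h𝒰fin.to_subtype
    obtain ⟨⟨U₀, hU₀⟩, hinf⟩ := Finite.exists_infinite_fiber
      (fun ℓ : L ↦ (⟨Uof ℓ, hUof𝒰 ℓ ℓ.2⟩ : 𝒰))
    refine ⟨U₀, hU₀, ?_⟩
    have hinj : Function.Injective (fun ℓ : ((fun ℓ : L ↦ (⟨Uof ℓ, hUof𝒰 ℓ ℓ.2⟩ : 𝒰)) ⁻¹'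
        {⟨U₀, hU₀⟩}) ↦ (ℓ : ℕ)) := fun a b h ↦ Subtype.ext (Subtype.ext h)
    refine Set.infinite_of_injective_forall_mem hinj ?_
    rintro ⟨⟨ℓ, hℓL⟩, hℓ⟩
    have hℓ' : Uof ℓ = U₀ := by
      have := congrArg Subtype.val (Set.mem_singleton_iff.mp hℓ)
      exact this
    exact ⟨hℓL, hℓ'⟩
  obtain ⟨hU₀o, hU₀i, hU₀I⟩ := hU₀𝒰
  -- Lemme 3: every good prime with a Frobenius outside `U₀` is supersingular
  refine false_of_frobenius_not_mem_subset_density_zero U₀ hU₀o hU₀i (↑s) s.finite_toSet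
    (fun p hp hps v hv 𝔓 h𝔓 ↦ ?_) hSS (fun p hp hps v hv 𝔓 h𝔓 σ hσ hσU ↦ ?_)
  · haveI := HeightOneSpectrum.isMaximal_of_mem_primesAbove h𝔓
    refine hU₀I 𝔓 inferInstance fun q hq hmem ↦ ?_
    have hqp : q ≠ p := fun h ↦ hps (h ▸ hq)
    exact Rat.natCast_not_mem_of_mem_primesAbove_of_not_dvd h𝔓
      (by rw [hv]; exact fun h ↦ hqp ((Nat.prime_dvd_prime_iff_eq hp (hsprime q hq)).mp h).symm)
      hmem
  · haveI := Fact.mk hp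
    have hgood : W.HasGoodReductionAtPrime p := hs p hps
    refine ⟨Fact.mk hp, hgood, ?_⟩
    have hzero : W.frobeniusTrace p = 0 := by
      apply eq_zero_of_infinite_setOf_prime_dvd
      refine Set.Infinite.mono ?_ (hL'inf.sdiff (Set.finite_singleton p))
      rintro ℓ ⟨⟨hℓL, hℓU⟩, hℓp⟩
      have hℓp' : p ≠ ℓ := fun h ↦ hℓp (Set.mem_singleton_iff.mpr h.symm)
      refine ⟨(hLprop ℓ hℓL).1, ?_⟩
      exact hUof3 ℓ hℓL p hℓp' hgood v hv 𝔓 h𝔓 σ hσ (hℓU ▸ hσU)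
    rw [hzero]
    exact dvd_zero _

/-- **Serre 1972, §4.2, Théorème 2 for globally minimal `E/ℚ`, conditional on §1.11** (the local
input `hF`) — the density input being discharged from the tree's named fact
`serre_supersingular_density_zero` (Serre 1981 §8 / 1968 IV-13; [26] cor. 1 au th. 6 in Serre's
text): for `E` without complex multiplication, `ρ̄_{E,ℓ}` is onto for all large `ℓ`.
[cite: Serre1972, §4.2, Théorème 2] -/
theorem serre_open_image_minimal_of_inertia_shape (hD : serre_supersingular_density_zero)
    (hF : ∀ (W : WeierstrassCurve ℚ) [W.IsElliptic] [W.IsGloballyMinimal] (ℓ : ℕ) [Fact ℓ.Prime],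
      W.HasGoodReductionAtPrime ℓ →
      ∀ v : HeightOneSpectrum (𝓞 ℚ), (primesEquiv v : ℕ) = ℓ → ∀ 𝔏 ∈ v.primesAbove,
        (letI : Module (ZMod ℓ) (geomTorsion W ℓ) := AddSubgroup.torsionBy.zmodModule
         ∃ v₀ : geomTorsion W ℓ, v₀ ≠ 0 ∧
           (∀ τ ∈ 𝔏.inertia (absoluteGaloisGroup ℚ), ∀ x : geomTorsion W ℓ,
              ∃ b : ZMod ℓ, τ • x - x = b • v₀) ∧
           (∀ a : (ZMod ℓ)ˣ, ∃ τ ∈ 𝔏.inertia (absoluteGaloisGroup ℚ),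
              τ • v₀ = (a : ZMod ℓ) • v₀)) ∨
        (IsCyclic ((𝔏.inertia (absoluteGaloisGroup ℚ)).map (galoisRepTorsion W ℓ)) ∧
          Nat.card ((𝔏.inertia (absoluteGaloisGroup ℚ)).map (galoisRepTorsion W ℓ)) =
            ℓ ^ 2 - 1)) :
    ∀ (W : WeierstrassCurve ℚ) [W.IsElliptic] [W.IsGloballyMinimal], ¬ W.HasCM →
      ∃ p₀ : ℕ, ∀ p : ℕ, p.Prime → p₀ ≤ p → W.HasSurjectiveModNGaloisRep p :=
  fun W _ _ hCM ↦ W.exists_forall_hasSurjectiveModNGaloisRep_of_inertia_shape (hD W hCM)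
    (fun ℓ _ ↦ hF W ℓ)

end WeierstrassCurve
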